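import Summits.ResolutionOfSingularities.ResolutionOfSingularities.Theorems.PurelyInseparableDim4JointTree
import Summits.ResolutionOfSingularities.ResolutionOfSingularities.Theorems.PurelyInseparableDim4ChartZigzagBoundary
import HarnessLib

/-!
# Purely inseparable four-folds: the TRANSLATED SHAPE of the boundary SURVIVES at a member not blown up (brick S3 (c)
# «joint point∘coordinate chains», part 11 = stage (B) of the tree's v2, cell `res-dim4-pi`)

[OURS · counted 0] (D-0157 DOOR 2; desk WORD #66 (4)(c), #74 (g); frame `PIDim4.TerminationImpliesOrderReduction`,
S3 (c); host item stmt-ResolutionOfSingularities-16155, helper). Nothing here proves resolution of singularities in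
dimension ≥ 4 / characteristic `p` — NOT here, not anywhere in this programme.

In v2 of the joint tree a coordinate member carries, besides its zigzag chart, typ-2 g3's FC-1 datum: the TRANSLATED
SHAPE `(idx, cst)` of the boundary relative to the chart (`D.comap φ = (x_{idx D} + cst D)·𝒪` on `ψ`, `cst D = 0` when
`idx D ∈ S`, `idx` injective — for the members `D` meeting the centre). When ANOTHER member is blown up
(`π : W → X′` along `C`, our member `c` disjoint from `V(C)`), part 4 transported the zigzag chart
(`member_survival_zigzag`); here the shape comes along:

* `strictTransformIdeal_top` — with the unit ideal as centre the strict transform is the total transform;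
* `comap_strictTransformIdeal_zigzag_survival` — on the survivor's chart `φ′ = φ| ≫ (π|)⁻¹ ≫ ι` every strict transform
  reads as the old member did: `(πˢ(D)).comap φ′ = (D.comap φ).comap ι` (GW (13.19) restricted over `X′ ∖ V(C)`);
* **`member_survival_zigzag_shape`** — part 4's four survival conjuncts PLUS the shape of
  `(M′.transform π C).boundary = (strict transforms) ++ [exceptional]` relative to `(φ′, ψ′, S)`: strict transforms
  of members meeting `c` keep their `(idx, cst)`; the exceptional divisor does not meet the survivor.

AI-produced formalisation, weaker than expert review. bears_on: LADDER-RESOLUTION:D157-DOOR2 (res-dim4-pi · S3 (c) joint v2 (B)).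
-/

set_option linter.dupNamespace false -- D-0017: single-problem summit path `Summit.<S>.<S>.…` by design

noncomputable section

open MvPolynomial Finset CategoryTheory AlgebraicGeometry Opposite TopologicalSpace
open AlgebraicGeometry.Scheme.IdealSheafData (ofIdealTop vanishingIdeal)

namespace Summit.ResolutionOfSingularities.ResolutionOfSingularities.Theorems.PIDim4

open Literature.AlgebraicGeometry.Resolution
open Literature.AlgebraicGeometry.Resolution.AffinePointBlowup (P A γ coord Wtop ξ)

namespace Equimultiple

universe u

/-! ## §1 Strict transforms read on a survivor's chart -/

section Strict

variable {X' W Y : Scheme.{u}} {π : W ⟶ X'} {Ce : X'.IdealSheafData}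

/-- With the unit ideal as centre the strict transform is the total transform. [cite: GortzWedhorn2020, (13.19)] -/
theorem strictTransformIdeal_top {Z' : Scheme.{u}} (σ : Z' ⟶ X') (K : X'.IdealSheafData) :
    strictTransformIdeal σ ⊤ K = K.comap σ := by
  rw [strictTransformIdeal, Scheme.IdealSheafData.comap_top]
  simp_rw [← Scheme.IdealSheafData.one_eq_top, one_pow, Scheme.IdealSheafData.one_eq_top, colon_top]
  exact iSup_const

/-- **Strict transforms read on the survivor's chart as before**: for `O` disjoint from `V(C)` (so `π|_O` is an
isomorphism) and `φ : Y ⟶ X′`, along `φ′ = (φ|_O) ≫ (π|_O)⁻¹ ≫ ι` every strict transform `πˢ(D)` reads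
`(D.comap φ)|_{φ⁻¹O}`. [cite: GortzWedhorn2020, (13.19)] [cite: StacksProject, Tag 02OS] -/
theorem comap_strictTransformIdeal_zigzag_survival [IsLocallyNoetherian W] {O : X'.Opens} [IsIso (π ∣_ O)]
    (hO : Disjoint (O : Set X') Ce.support) (φ : Y ⟶ X') (D : X'.IdealSheafData) :
    (strictTransformIdeal π Ce D).comap ((φ ∣_ O) ≫ inv (π ∣_ O) ≫ (π ⁻¹ᵁ O).ι) =
      (D.comap φ).comap (φ ⁻¹ᵁ O).ι := by
  rw [Scheme.IdealSheafData.comap_comp, Scheme.IdealSheafData.comap_comp, ← strictTransformIdeal_morphismRestrict,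
    comap_ι_eq_top_of_disjoint Ce hO, strictTransformIdeal_top, ← Scheme.IdealSheafData.comap_comp _ (inv (π ∣_ O)),
    IsIso.inv_hom_id, Scheme.IdealSheafData.comap_id, ← Scheme.IdealSheafData.comap_comp, morphismRestrict_ι,
    Scheme.IdealSheafData.comap_comp]

end Strict

/-! ## §2 Survival of a member together with the shape of the boundary -/

section Shape

variable {K : Type} [Field K]
variable {X' W Y : Scheme.{0}} {π : W ⟶ X'} {Ce : X'.IdealSheafData} {S : Finset (Fin 4)}

/-- **SURVIVAL WITH SHAPE.** `π : W → X′` a blowing up along `C`, `c ⊆ X′` closed and disjoint from `V(C)`, a zigzag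
chart `X′ ←φ— Y —ψ→ 𝔸⁵` with `I.comap φ = J.comap ψ`, `(vanishingIdeal c).comap φ = (𝓘Λ S).comap ψ`, `c ⊆ range φ`,
`V(z, x_S) ⊆ range ψ`, and the translated shape `(idx, cst)` of a boundary `E` relative to `(φ, ψ, S)`. Then at `W`:
a zigzag chart `W ←φ′— Y′ —ψ′→ 𝔸⁵` reading `πᶜ(I, μ)` as `J`, reading `vanishingIdeal (π⁻¹c)` as `𝓘Λ S`, covering
`π⁻¹c`, seeing `V(z, x_S)`, AND the translated shape of `E.map (strictTransformIdeal π Ce) ++ [Ce.comap π]` relative to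
`(φ′, ψ′, S)`. [cite: BierstoneGrigorievMilmanWlodarczyk2011, Def. 3.1.3 (2), (4)] [cite: StacksProject, Tag 02OS] -/
theorem member_survival_zigzag_shape [IsLocallyNoetherian X'] [IsLocallyNoetherian W] (hπ : IsBlowup π Ce)
    (c : Closeds X') (hdisj : Disjoint (c : Set X') (Ce.support : Set X')) (φ : Y ⟶ X') [IsOpenImmersion φ]
    (ψ : Y ⟶ P 4 K) [IsOpenImmersion ψ] (I : X'.IdealSheafData) (J : (P 4 K).IdealSheafData)
    (hI : I.comap φ = J.comap ψ) (μ : ℕ)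
    (hZ : (vanishingIdeal c).comap φ = (AffineCoordBlowup.𝓘Λ 4 K (insert 0 (Fin.succ '' (S : Set (Fin 4))))).comap ψ)
    (hcφ : (c : Set X') ⊆ Set.range φ)
    (hsee : (AffineCoordBlowup.CΛ 4 K (insert 0 (Fin.succ '' (S : Set (Fin 4)))) : Set (P 4 K)) ⊆ Set.range ψ)
    (E : List X'.IdealSheafData) (idx : X'.IdealSheafData → Fin 4) (cst : X'.IdealSheafData → K)
    (hshape : ∀ D ∈ E,
      ((D.support : Set X') ∩ φ '' (ψ ⁻¹'
        (AffineCoordBlowup.CΛ 4 K (insert 0 (Fin.succ '' (S : Set (Fin 4)))) : Set (P 4 K)))).Nonempty →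
      D.comap φ = (ofIdealTop (Ideal.span {(γ 4 K).symm (X (idx D).succ + C (cst D))})).comap ψ ∧
        (idx D ∈ S → cst D = 0))
    (hinj : ∀ D₁ ∈ E, ∀ D₂ ∈ E,
      ((D₁.support : Set X') ∩ φ '' (ψ ⁻¹'
        (AffineCoordBlowup.CΛ 4 K (insert 0 (Fin.succ '' (S : Set (Fin 4)))) : Set (P 4 K)))).Nonempty →
      ((D₂.support : Set X') ∩ φ '' (ψ ⁻¹'
        (AffineCoordBlowup.CΛ 4 K (insert 0 (Fin.succ '' (S : Set (Fin 4)))) : Set (P 4 K)))).Nonempty →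
      idx D₁ = idx D₂ → D₁ = D₂) :
    ∃ (Y' : Scheme.{0}) (φ' : Y' ⟶ W) (ψ' : Y' ⟶ P 4 K) (_ : IsOpenImmersion φ') (_ : IsOpenImmersion ψ'),
      (controlledTransform π Ce I μ).comap φ' = J.comap ψ' ∧
      (vanishingIdeal (c.preimage π.continuous)).comap φ' =
        (AffineCoordBlowup.𝓘Λ 4 K (insert 0 (Fin.succ '' (S : Set (Fin 4))))).comap ψ' ∧
      ((c.preimage π.continuous : Closeds W) : Set W) ⊆ Set.range φ' ∧
      (AffineCoordBlowup.CΛ 4 K (insert 0 (Fin.succ '' (S : Set (Fin 4)))) : Set (P 4 K)) ⊆ Set.range ψ' ∧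
      ∃ (idx₂ : W.IdealSheafData → Fin 4) (cst₂ : W.IdealSheafData → K),
        (∀ D₂ ∈ E.map (strictTransformIdeal π Ce) ++ [Ce.comap π],
          ((D₂.support : Set W) ∩ φ' '' (ψ' ⁻¹'
            (AffineCoordBlowup.CΛ 4 K (insert 0 (Fin.succ '' (S : Set (Fin 4)))) : Set (P 4 K)))).Nonempty →
          D₂.comap φ' = (ofIdealTop (Ideal.span {(γ 4 K).symm (X (idx₂ D₂).succ + C (cst₂ D₂))})).comap ψ' ∧
            (idx₂ D₂ ∈ S → cst₂ D₂ = 0)) ∧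
        (∀ D₁ ∈ E.map (strictTransformIdeal π Ce) ++ [Ce.comap π], ∀ D₂ ∈ E.map (strictTransformIdeal π Ce) ++ [Ce.comap π],
          ((D₁.support : Set W) ∩ φ' '' (ψ' ⁻¹'
            (AffineCoordBlowup.CΛ 4 K (insert 0 (Fin.succ '' (S : Set (Fin 4)))) : Set (P 4 K)))).Nonempty →
          ((D₂.support : Set W) ∩ φ' '' (ψ' ⁻¹'
            (AffineCoordBlowup.CΛ 4 K (insert 0 (Fin.succ '' (S : Set (Fin 4)))) : Set (P 4 K)))).Nonempty →
          idx₂ D₁ = idx₂ D₂ → D₁ = D₂) := by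
  classical
  set O : X'.Opens := ⟨(Ce.support : Set X')ᶜ, Ce.support.isClosed.isOpen_compl⟩ with hO_def
  have hO : Disjoint (O : Set X') Ce.support := disjoint_compl_left
  haveI : IsIso (π ∣_ O) := hπ.isIso_morphismRestrict hO
  have hcO : ∀ x : X', x ∈ (c : Set X') → x ∈ O := fun x hx h => hdisj.le_bot ⟨hx, h⟩
  have hmem := mem_member_iff_mem_CΛ φ ψ c hZ
  -- the transported chart (the construction of part 4, made explicit)
  set φ' : (φ ⁻¹ᵁ O : Scheme.{0}) ⟶ W := (φ ∣_ O) ≫ inv (π ∣_ O) ≫ (π ⁻¹ᵁ O).ι with hφ'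
  set ψ' : (φ ⁻¹ᵁ O : Scheme.{0}) ⟶ P 4 K := (φ ⁻¹ᵁ O).ι ≫ ψ with hψ'
  have hfac : φ' ≫ π = (φ ⁻¹ᵁ O).ι ≫ φ := comp_eq_of_zigzag_survival φ
  have hφ'π : ∀ y, π (φ' y) = φ ((φ ⁻¹ᵁ O).ι y) := fun y => by
    rw [← Scheme.Hom.comp_apply, hfac, Scheme.Hom.comp_apply]
  -- the survivor's centre set on the new chart is the old one
  have himg' : φ' '' (ψ' ⁻¹' (AffineCoordBlowup.CΛ 4 K (insert 0 (Fin.succ '' (S : Set (Fin 4)))) : Set (P 4 K))) ⊆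
      π ⁻¹' (φ '' (ψ ⁻¹' (AffineCoordBlowup.CΛ 4 K (insert 0 (Fin.succ '' (S : Set (Fin 4)))) : Set (P 4 K)))) := by
    rintro _ ⟨y, hy, rfl⟩
    rw [Set.mem_preimage, hφ'π]
    exact ⟨_, hy, rfl⟩
  -- members of the new boundary meeting the survivor come from members meeting `c`
  have hmeet : ∀ D₂ ∈ E.map (strictTransformIdeal π Ce) ++ [Ce.comap π],
      ((D₂.support : Set W) ∩ φ' '' (ψ' ⁻¹'
        (AffineCoordBlowup.CΛ 4 K (insert 0 (Fin.succ '' (S : Set (Fin 4)))) : Set (P 4 K)))).Nonempty →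
      ∃ D ∈ E, strictTransformIdeal π Ce D = D₂ ∧
        ((D.support : Set X') ∩ φ '' (ψ ⁻¹'
          (AffineCoordBlowup.CΛ 4 K (insert 0 (Fin.succ '' (S : Set (Fin 4)))) : Set (P 4 K)))).Nonempty := by
    intro D₂ hD₂ hne
    obtain ⟨w, hwD, hwc⟩ := hne
    have hπw := himg' hwc
    rw [Set.mem_preimage] at hπw
    rcases List.mem_append.mp hD₂ with hD₂ | hD₂
    · obtain ⟨D, hD, rfl⟩ := List.mem_map.mp hD₂
      refine ⟨D, hD, rfl, π w, ?_, hπw⟩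
      have hle : D.comap π ≤ strictTransformIdeal π Ce D :=
        (comap_le_controlledTransform π Ce D 0).trans (controlledTransform_le_strictTransformIdeal π Ce D 0)
      have hw' := Scheme.IdealSheafData.support_antitone hle hwD
      rw [Scheme.IdealSheafData.support_comap] at hw'
      exact hw'
    · -- the exceptional divisor does not meet the survivor
      exfalso
      rw [List.mem_singleton] at hD₂
      subst hD₂
      rw [Scheme.IdealSheafData.support_comap] at hwD
      have hπwc : π w ∈ (c : Set X') := by
        obtain ⟨y, hy, hyw⟩ := hπw
        rw [← hyw]
        exact (hmem y).mpr hy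
      exact hdisj.le_bot ⟨hπwc, hwD⟩
  -- the new shape data: read through a chosen old member
  let pick : W.IdealSheafData → X'.IdealSheafData := fun D₂ =>
    if h : ∃ D ∈ E, strictTransformIdeal π Ce D = D₂ ∧
        ((D.support : Set X') ∩ φ '' (ψ ⁻¹'
          (AffineCoordBlowup.CΛ 4 K (insert 0 (Fin.succ '' (S : Set (Fin 4)))) : Set (P 4 K)))).Nonempty
    then h.choose else ⊤
  have hpick : ∀ D₂ ∈ E.map (strictTransformIdeal π Ce) ++ [Ce.comap π],
      ((D₂.support : Set W) ∩ φ' '' (ψ' ⁻¹'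
        (AffineCoordBlowup.CΛ 4 K (insert 0 (Fin.succ '' (S : Set (Fin 4)))) : Set (P 4 K)))).Nonempty →
      pick D₂ ∈ E ∧ strictTransformIdeal π Ce (pick D₂) = D₂ ∧
        (((pick D₂).support : Set X') ∩ φ '' (ψ ⁻¹'
          (AffineCoordBlowup.CΛ 4 K (insert 0 (Fin.succ '' (S : Set (Fin 4)))) : Set (P 4 K)))).Nonempty := by
    intro D₂ hD₂ hne
    have h := hmeet D₂ hD₂ hne
    have hp : pick D₂ = h.choose := dif_pos h
    rw [hp]
    exact h.choose_spec
  refine ⟨(φ ⁻¹ᵁ O : Y.Opens), φ', ψ', inferInstance, inferInstance, ?_, ?_, ?_, ?_,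
    fun D₂ => idx (pick D₂), fun D₂ => cst (pick D₂), fun D₂ hD₂ hne => ?_, fun D₁ hD₁ D₂ hD₂ hne₁ hne₂ hidx => ?_⟩
  · rw [hφ', Scheme.IdealSheafData.comap_comp, Scheme.IdealSheafData.comap_comp, comap_controlledTransform_ι_of_disjoint Ce I hO,
      ← Scheme.IdealSheafData.comap_comp _ (inv (π ∣_ O)), IsIso.inv_hom_id, Scheme.IdealSheafData.comap_id,
      ← Scheme.IdealSheafData.comap_comp, morphismRestrict_ι, Scheme.IdealSheafData.comap_comp, hI,
      ← Scheme.IdealSheafData.comap_comp]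
  · rw [← hπ.comap_vanishingIdeal_of_disjoint c hdisj, ← Scheme.IdealSheafData.comap_comp, hfac,
      Scheme.IdealSheafData.comap_comp, hZ, ← Scheme.IdealSheafData.comap_comp]
  · intro w hw
    have hwc : π w ∈ (c : Set X') := hw
    obtain ⟨y, hy⟩ := hcφ hwc
    have hyO : y ∈ φ ⁻¹ᵁ O := by
      change φ y ∈ O
      rw [hy]
      exact hcO _ hwc
    have hwO : w ∈ π ⁻¹ᵁ O := hcO _ hwc
    refine ⟨⟨y, hyO⟩, ?_⟩
    have h1 : (φ ∣_ O) ⟨y, hyO⟩ = (π ∣_ O) ⟨w, hwO⟩ := by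
      apply Subtype.ext
      rw [morphismRestrict_base_coe, morphismRestrict_base_coe]
      exact hy
    rw [hφ', Scheme.Hom.comp_apply, Scheme.Hom.comp_apply, h1, ← Scheme.Hom.comp_apply (π ∣_ O), IsIso.hom_inv_id]
    rfl
  · intro v hv
    obtain ⟨y, hy⟩ := hsee hv
    have hyc : φ y ∈ (c : Set X') := (hmem y).mpr (by rw [hy]; exact hv)
    exact ⟨⟨y, hcO _ hyc⟩, by rw [hψ', Scheme.Hom.comp_apply]; exact hy⟩
  · -- the reading of a meeting member
    obtain ⟨hD, hst, hne'⟩ := hpick D₂ hD₂ hne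
    obtain ⟨hread, hzero⟩ := hshape _ hD hne'
    refine ⟨?_, hzero⟩
    show D₂.comap φ' = (ofIdealTop (Ideal.span {(γ 4 K).symm (X (idx (pick D₂)).succ + C (cst (pick D₂)))})).comap ψ'
    conv_lhs => rw [← hst, hφ', comap_strictTransformIdeal_zigzag_survival hO φ, hread]
    rw [hψ', ← Scheme.IdealSheafData.comap_comp]
  · -- injectivity of the index on meeting members
    obtain ⟨hD₁', hst₁, hne₁'⟩ := hpick D₁ hD₁ hne₁
    obtain ⟨hD₂', hst₂, hne₂'⟩ := hpick D₂ hD₂ hne₂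
    have h := hinj _ hD₁' _ hD₂' hne₁' hne₂' hidx
    rw [← hst₁, ← hst₂, h]

end Shape

end Equimultiple

end Summit.ResolutionOfSingularities.ResolutionOfSingularities.Theorems.PIDim4

end
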